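import Literature.NumberTheory.Automorphic.Liu2021.CheckOfChiCompanionCharacter
import Literature.NumberTheory.Automorphic.Liu2021.Def411WeilCarriersDoublingDetTwist
import Literature.NumberTheory.Automorphic.Liu2021.Def411WeilCarriersAtLine
import Literature.NumberTheory.Automorphic.Liu2021.Def411WeilCarriersChiUnitary
import Literature.NumberTheory.GelbartRogawski1991.UnitaryDualPairWeilCoinvariantsTwist
import Literature.NumberTheory.Automorphic.UnitaryGroupAdelicDet
import Literature.NumberTheory.Automorphic.NormOneIdeleClassCompact
import HarnessLib

/-!
# F0 · P5 pay-down line `Cruxes/HLiu418/Lines/F0_P5_CurveThetaLettersPaydown` (ED. 3), stub R2G `CompanionDetTwist₂`: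
# §1 — the DET-TWIST CHARACTER `α(u) = Λ(u)⁻¹ · χ(u_f)` of the companion label `λᶜ·χ̌` ([Liu2021, Lem. D.1 (4)])

Cell `hodgecm-mathlib`, floor 0, programme P5 (Alb-CM); crux item `stmt-HodgeConjecture-24832`
(`Summit.HodgeConjecture.HodgeConjecture.Theses.HCCMUnconditional.HLiu418`).  The pay-down line's ED. 3 (F0P5-plan (g4), 2026-08-31)
splits the semi-local stub R2′ `CompanionRelabelTransfer₂` into R2G `CompanionDetTwist₂` (GLOBAL: the companion relabel
`λ ↦ λ′ = λᶜ·χ̌` is a determinant twist of [Liu2021, Def. 4.11]'s finite Weil carrier) and R2″ `FlipTransferTwisted₂` (the line flip at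
ONE splitting family); the composition R2G + R2″ ⇒ R2′ is proved in the line.  THIS FILE is §1 of the proof of R2G (helpers, landed as
they close; the head `stub_sl_companionDetTwist_holds` is APPENDED by the next edition of this file):

for `L` CM, `lam : C_L →ₜ* S¹`, `χ ∈ Chi L⁺ L 𝔠` ([Liu2021, Def. 4.11]'s automorphic characters of `L¹\U(1)(𝔸_{L⁺,f})`) and ANY
homomorphism `α : U(1)(𝔸_{L⁺}) →* ℂˣ` satisfying the pointwise spec `α u = Λ(u)⁻¹ · χ(u_f)` (`Λ := toHeckeCharacter L lam`,
`u_f := finitePart u ∈ U(1)(𝔸_{L⁺,f})`, ★ `finitePart_mem_finAdelicOne`) — the ∀-bound twist datum of `CompanionDetTwist₂`: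

* `continuous_alpha` — `α` is continuous;
* `alpha_eq_one_of_mem_principalIdeles` — `α` is AUTOMORPHIC (trivial on the principal norm-one idèles: `Λ((k)) = 1` and `χ((k)_f) = 1`
  for `k ∈ L¹`, the `IsAutomorphicOneChar` clause of `Chi`);
* `norm_alpha` — `α` is unitary (★ `isUnitary_toHeckeCharacter`, ★ `norm_chi_apply_eq_one_cm`);
* **`toHeckeCharacter_galConj_mul_checkOfChi_eq_mul_ratioHecke`** — (T1) `Λᶜ · χ̌ = Λ · α̃` as Hecke characters, `α̃ := ratioHecke L α`
  (`α̃(d) = α(d/d̄)`, ★ `DoubledWeilRepresentationDetTwist`), proved POINTWISE: `Λ(d̄)·χ(d_f/d̄_f) = Λ(d)·Λ(d/d̄)⁻¹·χ((d/d̄)_f)`.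

These are exactly the three side conditions `hα`, `hαrat`, `hαu` and the character rewrite under which ★
`Def411WeilCarriersDoublingDetTwist.chiSplittingLine_mul_ratioHecke` turns the splitting attached to `λ′` into the `α ∘ det`-twist of the
splitting attached to `λ` ([GelbartRogawski1991, Remark p. 457]; [HarrisKudlaSweet1996, §1]; [Liu2021, App. D Step 2]) — §2–§4 of the
proof (transport of `finPairRepW` along the splitting equality, ★ `weilCoinvTwistEquiv`, the `pairDet` plumbing) follow in the next edition.
No `def`, no named fact, no instance, no notation, no `sorry`.  Recon memo: `F0/P5/B-p08/g21/R2prime-routeG-recon.B-p08g21.md`.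

HONEST LABEL: HC_CM is proved only modulo the printed citations — the 2 remaining named inputs (hLiu418, h413) — until rung 0
closes; this file proves helper lemmas toward ONE registered stub of ONE floor-0 pay-down line and discharges no letter by itself.

## References
* [Liu2021] Y. Liu, *Fourier–Jacobi cycles and arithmetic relative trace formula*, Camb. J. Math. 9 (2021) = arXiv:2102.11518:
  Def. 4.11 (l. 2083–2097), App. D §D.1 (l. 5224: `χ̌(x) = χ(x/xᶜ)`), Lem. D.1 (4) (l. 5235), Rem. 4.4.
* [GelbartRogawski1991] S. Gelbart, J. Rogawski, *L-functions and Fourier–Jacobi coefficients for the unitary group U(3)*,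
  Invent. Math. 105 (1991), §3.1 Remark p. 457 L4–13.
* [HarrisKudlaSweet1996] M. Harris, S. Kudla, W. J. Sweet, *Theta dichotomy for unitary groups*, J. AMS 9 (1996), §1 (1.14)–(1.15).
* Tree: ★ `Liu2021.CheckOfChi` (`checkOfChi_apply`, `finAdelicCheck`, `idelicFinPart`), ★ `Liu2021.CheckOfChiCompanionCharacter`,
  ★ `IdeleClassCharacterConjugate.toHeckeCharacter_galConj`, ★ `GRConstruction.DoubledWeilDetTwist` (`idelesRatio`, `ratioHecke`,
  `conjIdele_eq_smul`), ★ `Liu2021.Def411WeilCarriersChiUnitary` (`finitePart_mem_finAdelicOne`, `norm_chi_apply_eq_one_cm`),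
  ★ `NormOneIdeleClassCompact` (`finitePart`).
-/

set_option autoImplicit false
set_option linter.dupNamespace false

noncomputable section

open NumberField NumberField.InfinitePlace IsDedekindDomain
open scoped Matrix Kronecker ComplexOrder
open Literature.NumberTheory.Automorphic Literature.NumberTheory.Automorphic.UnitaryGroup
open Literature.NumberTheory.Automorphic.Liu2021 Literature.NumberTheory.Automorphic.Liu2021.Def411WeilCarriers
open Literature.NumberTheory.Automorphic.Liu2021.Def411WeilCarriersDoubling
open Literature.NumberTheory.GaloisRepresentations Literature.NumberTheory.Automorphic.IdeleClassGroup
open Literature.NumberTheory.ComplexMultiplication (CMTypeOps.bar)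
open Literature.NumberTheory.GelbartRogawski1991 Literature.NumberTheory.GelbartRogawski1991.UnitaryDualPair
open Literature.NumberTheory.GelbartRogawski1991.UnitaryDualPair.WeilCoinv
open Literature.NumberTheory.GelbartRogawski1991.GRConstruction.DoubledWeilDetTwist
open Literature.NumberTheory.Weil1964
open Literature.RepresentationTheory (TwistedCoinv.Coinv TwistedCoinv.mk)
open Literature.RepresentationTheory.HarrisKudlaSweet1996

namespace Summit.HodgeConjecture.HodgeConjecture.Cruxes.HLiu418.F0P5CurveThetaCompanionDetTwist

variable (L : Type) [Field L] [NumberField L] [IsCMField L]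


/-! ## §1 The det-twist character `α(u) = Λ(u)⁻¹ · χ(u_f)` on `U(1)(𝔸_{L⁺})`: continuity, automorphy, unitarity -/

section Alpha

variable {L}
variable (lam : Literature.NumberTheory.Automorphic.IdeleClassGroup L →ₜ* Circle) (χ : Chi (↥(maximalRealSubfield L)) L (IsCMField.complexConj L))
  (α : UnitaryGroup.adelicOne (↥(maximalRealSubfield L)) L (IsCMField.complexConj L) →* ℂˣ)
  (hα : ∀ u, α u = (toHeckeCharacter L lam (u : ideleGroup L))⁻¹ *
      χ.1 ⟨finitePart L (u : ideleGroup L), finitePart_mem_finAdelicOne (↥(maximalRealSubfield L)) L (IsCMField.complexConj L) u.2⟩)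

include hα

/-- `α` is continuous (`Λ` and `χ` are, the finite part is a coordinate projection). [cite: Liu2021, Def. 4.11 (l. 2090)] -/
theorem continuous_alpha : Continuous α := by
  have h : Continuous fun u : ↥(UnitaryGroup.adelicOne (↥(maximalRealSubfield L)) L (IsCMField.complexConj L)) =>
      (toHeckeCharacter L lam (u : ideleGroup L))⁻¹ *
        χ.1 ⟨finitePart L (u : ideleGroup L),
          finitePart_mem_finAdelicOne (↥(maximalRealSubfield L)) L (IsCMField.complexConj L) u.2⟩ := by
    refine Continuous.mul ?_ ?_
    · exact ((map_continuous (toHeckeCharacter L lam).toContinuousMonoidHom).comp continuous_subtype_val).inv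
    · refine χ.2.1.comp (Continuous.subtype_mk ?_ _)
      exact (Continuous.units_map _ continuous_snd).comp continuous_subtype_val
  exact h.congr fun u => (hα u).symm

/-- `α` is AUTOMORPHIC: trivial on the principal norm-one idèles `(k)`, `k ∈ L¹` (`Λ((k)) = 1`; `(k)_f` is the diagonal image of
the rational norm-one element `k`, on which `χ` is trivial). [cite: Liu2021, Def. 4.11 (l. 2090)] -/
theorem alpha_eq_one_of_mem_principalIdeles (u : UnitaryGroup.adelicOne (↥(maximalRealSubfield L)) L (IsCMField.complexConj L))
    (hu : (u : ideleGroup L) ∈ principalIdeles L) : α u = 1 := by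
  rw [hα, (toHeckeCharacter L lam).map_principal hu, inv_one, one_mul]
  obtain ⟨k, hk⟩ := hu
  have hmem : Units.map (algebraMap L (FiniteAdeleRing (𝓞 L) L)).toMonoidHom k ∈ UnitaryGroup.finAdelicOne (↥(maximalRealSubfield L)) L (IsCMField.complexConj L) := by
    have h1 : finitePart L (u : ideleGroup L) = Units.map (algebraMap L (FiniteAdeleRing (𝓞 L) L)).toMonoidHom k :=
      Units.ext (by rw [← hk]; rfl)
    exact h1 ▸ finitePart_mem_finAdelicOne (↥(maximalRealSubfield L)) L (IsCMField.complexConj L) u.2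
  have key : (⟨finitePart L (u : ideleGroup L),
      finitePart_mem_finAdelicOne (↥(maximalRealSubfield L)) L (IsCMField.complexConj L) u.2⟩ :
        ↥(UnitaryGroup.finAdelicOne (↥(maximalRealSubfield L)) L (IsCMField.complexConj L))) =
      ⟨Units.map (algebraMap L (FiniteAdeleRing (𝓞 L) L)).toMonoidHom k, hmem⟩ :=
    Subtype.ext (Units.ext (show ((u : ideleGroup L) : AdeleRing (𝓞 L) L).2 = algebraMap L (FiniteAdeleRing (𝓞 L) L) k by
      rw [← hk]; rfl))
  rw [key]
  exact χ.2.2 k hmem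

/-- `α` is UNITARY (`Λ` is, and automorphic `χ` is — ★ `norm_chi_apply_eq_one_cm`). [cite: Liu2021, Def. 4.11 (l. 2090)] -/
theorem norm_alpha (u : UnitaryGroup.adelicOne (↥(maximalRealSubfield L)) L (IsCMField.complexConj L)) : ‖((α u : ℂˣ) : ℂ)‖ = 1 := by
  rw [hα, Units.val_mul, norm_mul, Units.val_inv_eq_inv_val, norm_inv, isUnitary_toHeckeCharacter L lam, inv_one, one_mul]
  exact norm_chi_apply_eq_one_cm L χ _

/-- **(T1) the companion label is a det-twist at the level of Hecke characters**: `Λᶜ · χ̌ = Λ · α̃`, `α̃(d) = α(d/d̄)`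
(★ `ratioHecke`), POINTWISE: `Λ(d̄)·χ(d_f/d̄_f) = Λ(d)·Λ(d/d̄)⁻¹·χ((d/d̄)_f)`.
[cite: Liu2021, App. D §D.1 (l. 5224), Lem. D.1 (4) (l. 5235)] [cite: GelbartRogawski1991, §3.1 Remark p. 457 L4–13] -/
theorem toHeckeCharacter_galConj_mul_checkOfChi_eq_mul_ratioHecke (hcc : (IsCMField.complexConj L) * (IsCMField.complexConj L) = 1) (hc : Continuous α)
    (hrat : ∀ u : UnitaryGroup.adelicOne (↥(maximalRealSubfield L)) L (IsCMField.complexConj L), (u : ideleGroup L) ∈ principalIdeles L → α u = 1) :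
    toHeckeCharacter L (IdeleClassGroup.galConj (IsCMField.complexConj L) lam) * HeckeCharacter.checkOfChi hcc χ =
      toHeckeCharacter L lam * ratioHecke L α hc hrat := by
  refine HeckeCharacter.ext fun d => ?_
  rw [HeckeCharacter.mul_apply, HeckeCharacter.mul_apply, toHeckeCharacter_galConj, HeckeCharacter.galConj_apply,
    ratioHecke_apply, hα]
  have hfin : (⟨finitePart L ((idelesRatio L d : UnitaryGroup.adelicOne (↥(maximalRealSubfield L)) L (IsCMField.complexConj L)) : ideleGroup L),
      finitePart_mem_finAdelicOne (↥(maximalRealSubfield L)) L (IsCMField.complexConj L) (idelesRatio L d).2⟩ : UnitaryGroup.finAdelicOne (↥(maximalRealSubfield L)) L (IsCMField.complexConj L)) =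
      finAdelicCheck (↥(maximalRealSubfield L)) L (IsCMField.complexConj L) hcc (idelicFinPart L d) := by
    apply Subtype.ext
    show finitePart L (((idelesRatio L d : ↥(UnitaryGroup.adelicOne (↥(maximalRealSubfield L)) L (IsCMField.complexConj L))) :
      ideleGroup L)) = _
    rw [coe_idelesRatio, map_div, coe_finAdelicCheck]
    congr 1
  rw [hfin, CheckOfChi.checkOfChi_apply, coe_idelesRatio, map_div, conjIdele_eq_smul, inv_div, ← mul_assoc, mul_div_cancel]

end Alpha

end Summit.HodgeConjecture.HodgeConjecture.Cruxes.HLiu418.F0P5CurveThetaCompanionDetTwist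

end
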